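import Literature.NumberTheory.QuadraticFields.RealQuadraticPrincipalCycle
import Mathlib.Algebra.Ring.Int.Parity
import HarnessLib

/-!
# The fundamental unit of a real quadratic order is the least unit exceeding one

Topic `NumberTheory/QuadraticFields`; continues `RealQuadraticPrincipalCycle.lean` (`fundUnit D`,
`ε = ∏_{k=1}^{p} ψ_k` over the principal cycle of the non-square discriminant `D ≡ 0, 1 (mod 4)`).
Theorem-only file (no definitions, no named facts). We prove Jacobson–Williams' identification of
the fundamental solution of `X² − DY² = ±4` with `θ_{p+1}` (*Solving the Pell Equation*, §3.3,
pp. 58–59; (5.33)): **every solution `X, Y ≥ 1` of `X² − DY² = ±4` satisfies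
`(X + Y√D)/2 = εᵏ` for some `k ≥ 1`**, in particular `ε ≤ (X + Y√D)/2` (`fundUnit_le`), so that
`ε = fundUnit D` is the fundamental unit `ε_D` of `𝒪_D` in the sense of op. cit. §4.3 and
`log ε` is the regulator `R_D` (op. cit. §5.3, p. 112).

Proof (op. cit. pp. 58–59): with `q = D mod 2`, `w = (X − qY)/2 ∈ ℤ` and `u = w + qY`, the unit
`η = (X + Y√D)/2 = u − Yδ̄` has `|δ − u/Y| = 1/(ηY) < 1/(2Y²)` once `D ≥ 9`, and `gcd(u, Y) = 1`
(a Bézout identity from the norm equation); by Legendre's theorem `u/Y` is a convergent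
`A_n/B_n` of `δ`, so `η = A_n − B_nδ̄ = ∏_{k=1}^{n+1} ψ_k` with norm `(−1)^{n+1} Q_{n+1}/2 = ±1`,
whence `Q_{n+1} = 2`, `x_{n+1} = x_p`, `p ∣ n + 1` and `η = ε^{(n+1)/p}`. The two discriminants
`D = 5, 8` below `9` are settled by computing their (one-term) cycles: `ε₅ = (1 + √5)/2`,
`ε₈ = 1 + √2`.

## References

* M. J. Jacobson, Jr., H. C. Williams, *Solving the Pell Equation*, CMS Books in Mathematics,
  Springer (2009), §3.3 pp. 58–59 (Table 3.1 for `D ∈ {5, 8, 12}`), §4.3, §5.3 (5.33).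
  [JacobsonWilliams2008]
-/

noncomputable section

open scoped Classical

namespace Literature.NumberTheory.QuadraticFields

namespace QuadIrr

variable {D : ℕ}

/-! ### Products over the cycle -/

/-- A product of `p` consecutive values of a `p`-periodic nowhere-zero sequence does not depend on
the starting point. [folklore] -/
theorem prod_range_shift_of_periodic {f : ℕ → ℝ} {p : ℕ} (hf : ∀ n, f (n + p) = f n)
    (hf0 : ∀ n, f n ≠ 0) (m : ℕ) :
    ∏ k ∈ Finset.range p, f (m + k) = ∏ k ∈ Finset.range p, f k := by
  induction m with
  | zero => simp
  | succ m ih =>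
    rw [← ih]
    have h1 : ∏ k ∈ Finset.range (p + 1), f (m + k) = (∏ k ∈ Finset.range p, f (m + k)) * f (m + p) :=
      Finset.prod_range_succ _ _
    have h2 : ∏ k ∈ Finset.range (p + 1), f (m + k) = (∏ k ∈ Finset.range p, f (m + (k + 1))) * f (m + 0) :=
      Finset.prod_range_succ' _ _
    rw [hf, add_zero] at *
    have h3 : (∏ k ∈ Finset.range p, f (m + (k + 1))) = ∏ k ∈ Finset.range p, f (m + k) :=
      mul_right_cancel₀ (hf0 m) (h2.symm.trans h1)
    rw [← h3]
    refine Finset.prod_congr rfl fun k _ => ?_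
    rw [Nat.add_right_comm, Nat.add_assoc]

/-- **`∏_{k=1}^{jp} ψ_k = εʲ`** along the expansion of `δ`. [cite: JacobsonWilliams2008, §5.3 (θ_{kp+1} = ε^k, proof of (5.33))] -/
theorem psiProd_mul_periodLength (hD : ¬ IsSquare D) (hD4 : D % 4 = 0 ∨ D % 4 = 1) (j : ℕ) :
    psiProd (principalStart D) (j * periodLength D) = fundUnit D ^ j := by
  induction j with
  | zero => simp [psiProd]
  | succ j ih =>
    rw [Nat.succ_mul, psiProd, Finset.prod_range_add, ← psiProd, ih, pow_succ]
    congr 1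
    rw [fundUnit, psiProd]
    simp only [iterate_succ_principalStart]
    have hper : ∀ n, psi (step^[n + periodLength D] (principalFirst D)) = psi (step^[n] (principalFirst D)) := by
      intro n
      rw [Function.iterate_add_apply, iterate_periodLength_principalFirst]
    have hne : ∀ n, psi (step^[n] (principalFirst D)) ≠ 0 := fun n => by
      have := (isReduced_iterate hD (isReduced_principalFirst hD hD4) n).one_lt_psi
      linarith
    exact prod_range_shift_of_periodic (f := fun n => psi (step^[n] (principalFirst D))) hper hne _

/-! ### Parity and coprimality bookkeeping -/

/-- `2 ∣ n² − n`. [folklore] -/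
theorem two_dvd_sq_sub_self (n : ℤ) : 2 ∣ n ^ 2 - n := by
  have h := Int.even_mul_succ_self (n - 1)
  rw [even_iff_two_dvd] at h
  have e : n ^ 2 - n = (n - 1) * (n - 1 + 1) := by ring
  rw [e]
  exact h

/-- `X ≡ qY (mod 2)` for a solution of `X² − DY² ≡ 0 (mod 2)` when `D ≡ q (mod 2)`.
[cite: JacobsonWilliams2008, §1.3 (X ≡ DY (mod 2) after (1.10))] -/
theorem two_dvd_sub_mul {X Y q : ℤ} (hq : 2 ∣ (D : ℤ) - q) (h : 2 ∣ X ^ 2 - D * Y ^ 2) :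
    2 ∣ X - q * Y := by
  have e : X - q * Y = -(X ^ 2 - X) + (X ^ 2 - D * Y ^ 2) + ((D : ℤ) - q) * Y ^ 2 + q * (Y ^ 2 - Y) := by
    ring
  rw [e]
  exact dvd_add (dvd_add (dvd_add (dvd_neg.mpr (two_dvd_sq_sub_self X)) h) (hq.mul_right _))
    ((two_dvd_sq_sub_self Y).mul_left _)

/-- Reduced quotients with `Q = 2` along the expansion of `δ` coincide with `x_p`.
[cite: JacobsonWilliams2008, §3.3 (P_{n+1} = P_1 when Q_{n+1} = s, p. 59)] -/
theorem iterate_eq_of_Q_eq_two (hD : ¬ IsSquare D) (hD4 : D % 4 = 0 ∨ D % 4 = 1) {n : ℕ}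
    (hQ : (step^[n + 1] (principalStart D)).Q = 2) :
    step^[n + 1] (principalStart D) = step^[periodLength D] (principalStart D) := by
  have h0 := isPreReduced_principalStart hD hD4
  have hp := periodLength_pos hD hD4
  obtain ⟨m, hm⟩ : ∃ m, periodLength D = m + 1 := ⟨periodLength D - 1, by omega⟩
  have hx : (step^[n + 1] (principalStart D)).IsReduced := h0.isReduced_iterate_succ hD n
  have hy : (step^[periodLength D] (principalStart D)).IsReduced := by
    rw [hm]; exact h0.isReduced_iterate_succ hD m
  have hQy := Q_iterate_periodLength hD hD4
  refine eq_of_isReduced_of_Q_eq_of_dvd hx hy (hQ.trans hQy.symm) ?_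
  rw [hQy]
  -- both `P`'s are `≡ D (mod 2)`
  have hdx := hx.2.1
  have hdy := hy.2.1
  rw [hQ] at hdx
  rw [hQy] at hdy
  have e : (step^[n + 1] (principalStart D)).P - (step^[periodLength D] (principalStart D)).P =
      -((D : ℤ) - (step^[n + 1] (principalStart D)).P ^ 2) + ((D : ℤ) - (step^[periodLength D] (principalStart D)).P ^ 2)
      - ((step^[n + 1] (principalStart D)).P ^ 2 - (step^[n + 1] (principalStart D)).P)
      + ((step^[periodLength D] (principalStart D)).P ^ 2 - (step^[periodLength D] (principalStart D)).P) := by ring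
  rw [e]
  exact dvd_add (dvd_sub (dvd_add (dvd_neg.mpr hdx) hdy) (two_dvd_sq_sub_self _)) (two_dvd_sq_sub_self _)

/-! ### The small discriminants `5` and `8` -/

/-- `2 < √5 < 3` and `2 < √8 < 3`. [folklore] -/
theorem sqrt_bounds_five_eight : (2 : ℝ) < Real.sqrt 5 ∧ Real.sqrt 5 < 3 ∧ (2 : ℝ) < Real.sqrt 8 ∧ Real.sqrt 8 < 3 := by
  refine ⟨?_, ?_, ?_, ?_⟩
  · rw [show (2 : ℝ) = Real.sqrt 4 by rw [show (4 : ℝ) = 2 ^ 2 by norm_num, Real.sqrt_sq (by norm_num)]]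
    exact Real.sqrt_lt_sqrt (by norm_num) (by norm_num)
  · rw [show (3 : ℝ) = Real.sqrt 9 by rw [show (9 : ℝ) = 3 ^ 2 by norm_num, Real.sqrt_sq (by norm_num)]]
    exact Real.sqrt_lt_sqrt (by norm_num) (by norm_num)
  · rw [show (2 : ℝ) = Real.sqrt 4 by rw [show (4 : ℝ) = 2 ^ 2 by norm_num, Real.sqrt_sq (by norm_num)]]
    exact Real.sqrt_lt_sqrt (by norm_num) (by norm_num)
  · rw [show (3 : ℝ) = Real.sqrt 9 by rw [show (9 : ℝ) = 3 ^ 2 by norm_num, Real.sqrt_sq (by norm_num)]]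
    exact Real.sqrt_lt_sqrt (by norm_num) (by norm_num)

/-- `ε₅ = (1 + √5)/2` (the cycle of `D = 5` is the fixed point `(1, 2)`). [cite: JacobsonWilliams2008, §3.3 Table 3.1] -/
theorem fundUnit_five : fundUnit 5 = (1 + 1 * Real.sqrt 5) / 2 := by
  obtain ⟨h2, h3, -, -⟩ := sqrt_bounds_five_eight
  have hpq : (principalStart 5).pq = 1 := by
    rw [pq, Int.floor_eq_iff]
    unfold val principalStart
    push_cast
    constructor <;> linarith
  have hstep : step (principalStart 5) = principalStart 5 := by
    rw [step, hpq]; rfl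
  have hper : periodLength 5 = 1 := by
    rw [periodLength, Function.minimalPeriod_eq_one_iff_isFixedPt, Function.IsFixedPt, principalFirst, hstep, hstep]
  have hD : ¬ IsSquare 5 := by
    rintro ⟨r, hr⟩
    have : r ≤ 2 := by nlinarith
    interval_cases r <;> omega
  rw [fundUnit, hper, psiProd, Finset.prod_range_one, zero_add, Function.iterate_one,
    psi_step hD (isPreReduced_principalStart hD (by norm_num)).isAdmissible, hpq]
  unfold conj principalStart
  push_cast
  ring

/-- `ε₈ = 1 + √2 = (2 + √8)/2` (the cycle of `D = 8` is the fixed point `(2, 2)`). [cite: JacobsonWilliams2008, §3.3 Table 3.1] -/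
theorem fundUnit_eight : fundUnit 8 = (2 + 1 * Real.sqrt 8) / 2 := by
  obtain ⟨-, -, h2, h3⟩ := sqrt_bounds_five_eight
  have hpq : (principalStart 8).pq = 1 := by
    rw [pq, Int.floor_eq_iff]
    unfold val principalStart
    push_cast
    constructor <;> linarith
  have hfirst : principalFirst 8 = ⟨2, 2⟩ := by
    rw [principalFirst, step, hpq]; rfl
  have hpq1 : (⟨2, 2⟩ : QuadIrr 8).pq = 2 := by
    rw [pq, Int.floor_eq_iff]
    unfold val
    push_cast
    constructor <;> linarith
  have hstep : step (⟨2, 2⟩ : QuadIrr 8) = ⟨2, 2⟩ := by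
    rw [step, hpq1]; rfl
  have hper : periodLength 8 = 1 := by
    rw [periodLength, Function.minimalPeriod_eq_one_iff_isFixedPt, Function.IsFixedPt, hfirst, hstep]
  have hD : ¬ IsSquare 8 := by
    rintro ⟨r, hr⟩
    have : r ≤ 2 := by nlinarith
    interval_cases r <;> omega
  rw [fundUnit, hper, psiProd, Finset.prod_range_one, zero_add, Function.iterate_one,
    psi_step hD (isPreReduced_principalStart hD (by norm_num)).isAdmissible, hpq]
  unfold conj principalStart
  push_cast
  ring

/-! ### Minimality -/

/-- **Every solution `X, Y ≥ 1` of `X² − DY² = ±4` is a positive power of `ε`** (`D ≥ 9`;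
Jacobson–Williams' argument through Legendre's theorem). [cite: JacobsonWilliams2008, §3.3 (pp. 58–59) with §5.3 (5.33)] -/
theorem exists_eq_fundUnit_pow (hD : ¬ IsSquare D) (hD4 : D % 4 = 0 ∨ D % 4 = 1) (h9 : 9 ≤ D)
    {X Y : ℤ} (hX : 1 ≤ X) (hY : 1 ≤ Y) (hXY : X ^ 2 - D * Y ^ 2 = 4 ∨ X ^ 2 - D * Y ^ 2 = -4) :
    ∃ k : ℕ, 1 ≤ k ∧ (X + Y * Real.sqrt D) / 2 = fundUnit D ^ k := by
  have h0 := isPreReduced_principalStart hD hD4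
  set q : ℤ := ((D % 2 : ℕ) : ℤ) with hq
  have hq01 : q = 0 ∨ q = 1 := by omega
  have hq2 : 2 ∣ (D : ℤ) - q := by
    have : ((D % 2 : ℕ) : ℤ) = (D : ℤ) % 2 := by push_cast; rfl
    omega
  have hq4 : 4 ∣ q ^ 2 - (D : ℤ) := by
    have : ((D % 2 : ℕ) : ℤ) = (D : ℤ) % 2 := by push_cast; rfl
    rcases hq01 with h | h <;> rw [h] <;> omega
  -- parity: `X = 2w + qY`
  have h4 : 2 ∣ X ^ 2 - D * Y ^ 2 := by rcases hXY with h | h <;> rw [h] <;> norm_num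
  obtain ⟨w, hw⟩ := two_dvd_sub_mul hq2 h4
  obtain ⟨c, hc⟩ := hq4
  set u : ℤ := w + q * Y with hu
  -- real-number set-up
  have hsD : Real.sqrt (D : ℝ) ^ 2 = D := sqrt_sq
  have hs3 : (3 : ℝ) ≤ Real.sqrt D := by
    rw [show (3 : ℝ) = Real.sqrt 9 by rw [show (9 : ℝ) = 3 ^ 2 by norm_num, Real.sqrt_sq (by norm_num)]]
    exact Real.sqrt_le_sqrt (by exact_mod_cast h9)
  have hXr : (1 : ℝ) ≤ X := by exact_mod_cast hX
  have hYr : (1 : ℝ) ≤ Y := by exact_mod_cast hY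
  have hXY' : (X : ℝ) ^ 2 - D * (Y : ℝ) ^ 2 = 4 ∨ (X : ℝ) ^ 2 - D * (Y : ℝ) ^ 2 = -4 := by
    rcases hXY with h | h
    · left; exact_mod_cast h
    · right; exact_mod_cast h
  set η : ℝ := (X + Y * Real.sqrt D) / 2 with hη
  set η' : ℝ := (X - Y * Real.sqrt D) / 2 with hη'
  have hηη' : η * η' = 1 ∨ η * η' = -1 := by
    rcases hXY' with h | h
    · left; rw [hη, hη']; nlinarith [h, hsD]
    · right; rw [hη, hη']; nlinarith [h, hsD]
  have hval : (principalStart D).val = (q + Real.sqrt D) / 2 := by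
    unfold val principalStart; push_cast; rfl
  have hconj : (principalStart D).conj = (q - Real.sqrt D) / 2 := by
    unfold conj principalStart; push_cast; rfl
  have hwr : (X : ℝ) = 2 * w + q * Y := by
    have : X = 2 * w + q * Y := by linarith
    exact_mod_cast this
  have hε : (u : ℝ) - Y * (principalStart D).conj = η := by
    rw [hconj, hη, hu, hwr]; push_cast; ring
  have hε' : (u : ℝ) - Y * (principalStart D).val = η' := by
    rw [hval, hη', hu, hwr]; push_cast; ring
  -- `X > 2Y`, so `η > 2Y` and `|δ − u/Y| < 1/(2Y²)`
  have hX2Y : 2 * (Y : ℝ) < X := by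
    have h1 : 4 * (Y : ℝ) ^ 2 < (X : ℝ) ^ 2 := by
      have : (9 : ℝ) ≤ D := by exact_mod_cast h9
      rcases hXY' with h | h <;> nlinarith
    nlinarith
  have hηY : 2 * (Y : ℝ) < η := by rw [hη]; nlinarith
  have hηpos : 0 < η := by linarith
  have happrox : |(principalStart D).val - u / Y| < 1 / (2 * (Y : ℝ) ^ 2) := by
    have hY0 : (0 : ℝ) < Y := by linarith
    have e : (principalStart D).val - u / Y = -η' / Y := by
      rw [← hε']; field_simp; ring
    have habs : |η'| = 1 / η := by
      have : |η * η'| = 1 := by rcases hηη' with h | h <;> simp [h]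
      rw [abs_mul, abs_of_pos hηpos] at this
      field_simp; linarith
    rw [e, abs_div, abs_neg, habs, abs_of_pos hY0, div_div, div_lt_div_iff_of_pos_left one_pos
      (by positivity) (by positivity)]
    nlinarith
  -- coprimality from the norm equation `w u + c Y Y = ±1`
  have hnormZ : 4 * (w * u + c * Y * Y) = X ^ 2 - D * Y ^ 2 := by
    rw [hu, show X = 2 * w + q * Y by linarith]
    linear_combination (-(Y ^ 2)) * hc
  have hcop : IsCoprime u Y := by
    rcases hXY with h | h
    · exact ⟨w, c * Y, by linarith⟩
    · exact ⟨-w, -(c * Y), by linarith⟩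
  -- Legendre
  obtain ⟨n, hn1, hn2⟩ := exists_eq_psiProd_of_abs_sub_lt hD h0 (by linarith) hcop happrox
  rw [hε] at hn1
  rw [hε'] at hn2
  -- the norm forces `Q_{n+1} = 2`
  have hnorm := psiProd_mul_psiBarProd hD h0.isAdmissible (n + 1)
  rw [← hn1, ← hn2] at hnorm
  have hQ2 : (step^[n + 1] (principalStart D)).Q = 2 := by
    have hQpos : 0 < (step^[n + 1] (principalStart D)).Q := (h0.isReduced_iterate_succ hD n).1
    have hQ0 : ((principalStart D).Q : ℝ) = 2 := by simp [principalStart]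
    rw [hQ0] at hnorm
    have habs : |((step^[n + 1] (principalStart D)).Q : ℝ)| = 2 := by
      have h1 : |η * η'| = 1 := by rcases hηη' with h | h <;> simp [h]
      rw [hnorm, abs_div, abs_mul, abs_pow, abs_neg, abs_one, one_pow, one_mul,
        abs_of_pos (two_pos : (0 : ℝ) < 2)] at h1
      linarith
    rw [abs_of_pos (by exact_mod_cast hQpos)] at habs
    exact_mod_cast habs
  -- hence `x_{n+1} = x_p` and `p ∣ n + 1`
  have heq := iterate_eq_of_Q_eq_two hD hD4 hQ2
  have hp := periodLength_pos hD hD4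
  obtain ⟨m, hm⟩ : ∃ m, periodLength D = m + 1 := ⟨periodLength D - 1, by omega⟩
  rw [hm, iterate_succ_principalStart, iterate_succ_principalStart] at heq
  have hmod := (iterate_eq_iterate_iff_modEq hD (isReduced_principalFirst hD hD4) n m).mp heq
  rw [← periodLength, hm] at hmod
  have hdvd : m + 1 ∣ n + 1 :=
    (Nat.modEq_zero_iff_dvd).mp ((hmod.add_right 1).trans (Nat.modEq_zero_iff_dvd.mpr dvd_rfl))
  obtain ⟨k, hk⟩ := hdvd
  refine ⟨k, ?_, ?_⟩
  · rcases Nat.eq_zero_or_pos k with h | h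
    · rw [h, mul_zero] at hk; omega
    · exact h
  · rw [hn1, hk, ← hm, mul_comm, psiProd_mul_periodLength hD hD4]

/-- **Minimality of the fundamental unit**: `ε ≤ (X + Y√D)/2` for every solution `X, Y ≥ 1` of
`X² − DY² = ±4` (all non-square `D ≡ 0, 1 (mod 4)`; `D = 5, 8` by their explicit cycles).
[cite: JacobsonWilliams2008, §3.3 (pp. 58–59, Table 3.1) and §4.3 (definition of ε_Δ)] -/
theorem fundUnit_le (hD : ¬ IsSquare D) (hD4 : D % 4 = 0 ∨ D % 4 = 1)
    {X Y : ℤ} (hX : 1 ≤ X) (hY : 1 ≤ Y) (hXY : X ^ 2 - D * Y ^ 2 = 4 ∨ X ^ 2 - D * Y ^ 2 = -4) :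
    fundUnit D ≤ (X + Y * Real.sqrt D) / 2 := by
  by_cases h9 : 9 ≤ D
  · obtain ⟨k, hk, hpow⟩ := exists_eq_fundUnit_pow hD hD4 h9 hX hY hXY
    rw [hpow]
    exact le_self_pow₀ (one_lt_fundUnit hD hD4).le (by omega)
  · have h5 := five_le hD hD4
    have hXr : (1 : ℝ) ≤ X := by exact_mod_cast hX
    have hYr : (1 : ℝ) ≤ Y := by exact_mod_cast hY
    interval_cases D
    · rw [fundUnit_five]
      have := Real.sqrt_nonneg (5 : ℝ)
      push_cast
      nlinarith
    · omega
    · omega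
    · rw [fundUnit_eight]
      have hs := Real.sqrt_nonneg (8 : ℝ)
      have hX2 : (2 : ℝ) ≤ X := by
        have : 2 ≤ X := by
          by_contra hlt
          have hX1 : X = 1 := by omega
          rw [hX1] at hXY
          push_cast at hXY
          rcases hXY with h | h
          · nlinarith [sq_nonneg Y]
          · have h8 : (8 : ℤ) ∣ 5 := ⟨Y ^ 2, by linarith⟩
            norm_num at h8
        exact_mod_cast this
      push_cast
      nlinarith

end QuadIrr

end Literature.NumberTheory.QuadraticFields

end
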